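import Summits.ResolutionOfSingularities.ResolutionOfSingularities.Theorems.FrobeniusLadderFRationalResolutionGaloisCharacteristicCentre
import HarnessLib

/-!
# Crux `FrobeniusLadder.FRationalResolution` (stmt-ResolutionOfSingularities-15317), line `redirect`,
# stub `stub_diagonalizableQuotientResolution` — SCHEME-SIDE ASSEMBLY: characteristic centres in the complete local rings resolve

The Galois route as ONE quotable statement in its final currency (this generation's `…GaloisCharacteristicCentre`): an integral `X`
locally of finite type over any field `K` with finitely many singular points has a resolution of singularities as soon as every
singular point `s` carries an affine open `Spec B ∋ s = ι 𝔭` (regular off `𝔭`), a finite Galois `K'/K`, a maximal ideal `𝔔'` of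
`B ⊗_K K'` over `𝔭`, and a proper ideal `J ⊇ (𝔔'Ê)ⁿ` of `Ê = ((B ⊗_K K')_{𝔔'})^` which is CHARACTERISTIC (mapped into itself by every
ring automorphism of `Ê`) and has `Bl_J(Spec Ê)` regular. For twisted forms of isolated diagonalizable quotient singularities the
candidate `J` is the intrinsic class-group centre of memo MEMO-15317-leafhand2-g16 §2 (its twist-stability is automatic; its regularity
is toric combinatorics, Conjecture C3-tot up to one conifold step).

* **`hasResolution_of_characteristic_ideals_adicCompletion`**.

Honest label: plumbing toward ONE leaf stub (no stub, crux or summit closed). No definitions, no named facts, no sorry.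
[cite: StacksProject, Tag 0CDQ; Tag 09EB] [cite: Kollar2007, §2.2] [cite: Matsumura1987, Thm. 8.11; Thm. 8.14]
-/

noncomputable section

-- single-problem summit: the doubled namespace component is forced
set_option linter.dupNamespace false

open CategoryTheory AlgebraicGeometry TopologicalSpace TensorProduct
open Literature.AlgebraicGeometry.Resolution
open Summit.ResolutionOfSingularities.ResolutionOfSingularities.Theorems.FRationalResolution

namespace Summit.ResolutionOfSingularities.ResolutionOfSingularities.Theorems.FRationalResolution.GaloisCharacteristicCentreGlobal

/-- **Characteristic centres in the complete local rings resolve** (the Galois route, scheme side, final currency).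
[cite: StacksProject, Tag 0CDQ; Tag 09EB] [cite: Kollar2007, §2.2] [cite: Matsumura1987, Thm. 8.11; Thm. 8.14] -/
theorem hasResolution_of_characteristic_ideals_adicCompletion (K : Type) [Field K] (X : Scheme.{0}) [IsIntegral X]
    (f : X ⟶ Spec (.of K)) [LocallyOfFiniteType f] (hfin : (Scheme.regularLocus X)ᶜ.Finite)
    (hchart : ∀ s : X, s ∉ Scheme.regularLocus X →
      ∃ (B : Type) (_ : CommRing B) (_ : IsDomain B) (_ : Algebra K B) (_ : Algebra.FiniteType K B)
        (ι : Spec (.of B) ⟶ X) (_ : IsOpenImmersion ι)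
        (_ : ι ≫ f = Spec.map (CommRingCat.ofHom (algebraMap K B)))
        (𝔭 : Ideal B) (h𝔭 : 𝔭.IsMaximal) (_ : 𝔭 ≠ ⊥) (_ : ι ⟨𝔭, h𝔭.isPrime⟩ = s)
        (_ : ∀ P : Spec (.of B), P.asIdeal ≠ 𝔭 → P ∈ Scheme.regularLocus (Spec (.of B)))
        (K' : Type) (_ : Field K') (_ : Algebra K K') (_ : FiniteDimensional K K') (_ : IsGalois K K')
        (𝔔' : Ideal (B ⊗[K] K')) (_ : 𝔔'.IsMaximal)
        (J : Ideal (AdicCompletion (IsLocalRing.maximalIdeal (Localization.AtPrime 𝔔')) (Localization.AtPrime 𝔔')))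
        (n : ℕ),
          𝔔'.comap (algebraMap B (B ⊗[K] K')) = 𝔭 ∧
          𝔔'.map (algebraMap (B ⊗[K] K')
            (AdicCompletion (IsLocalRing.maximalIdeal (Localization.AtPrime 𝔔')) (Localization.AtPrime 𝔔'))) ^ n ≤ J ∧
          J ≠ ⊤ ∧
          (∀ θ : AdicCompletion (IsLocalRing.maximalIdeal (Localization.AtPrime 𝔔')) (Localization.AtPrime 𝔔') ≃+*
              AdicCompletion (IsLocalRing.maximalIdeal (Localization.AtPrime 𝔔')) (Localization.AtPrime 𝔔'), J.map θ ≤ J) ∧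
          Scheme.IsRegular (affineBlowup J)) :
    Scheme.HasResolution X := by
  refine IsolatedGlue.hasResolution_of_finite_singularLocus_of_local K X f hfin fun s hs => ?_
  obtain ⟨B, _, _, _, _, ι, _, hι, 𝔭, h𝔭, h𝔭0, hιs, hregB, K', _, _, _, _, 𝔔', _, J, n, h𝔔'𝔭, hpJ, hJp, hchar, hregJ⟩ :=
    hchart s hs
  subst hιs
  exact GaloisCharacteristicCentre.hloc_of_characteristic_ideal_adicCompletion K X f ι hι 𝔭 h𝔭0 hs hregB K' 𝔔' h𝔔'𝔭 J
    hpJ hJp hchar hregJ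

end Summit.ResolutionOfSingularities.ResolutionOfSingularities.Theorems.FRationalResolution.GaloisCharacteristicCentreGlobal

end
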